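import Mathlib

/-!
# Stub `stub_pressureForcesGap` for the crux `WeakCouplingHypercubicLimit` (line `Sketch`)

**"`m → ∞` kills the volume."**  Normalised spectral data `rᵢ ∈ [0, 1]` (`i < n`) of a transfer
matrix with its top eigenvalue removed; if the trace excess obeys the free-energy type bound

  `log (1 + Σᵢ rᵢ ^ m) ≤ V · C · e^{-μ m}`  for all `m ≥ m₀`,

with an ARBITRARY (volume) prefactor `V > 0`, then every `rᵢ ≤ e^{-μ}`, i.e. the spectral gap is at
least `μ`.  Proof (elementary real analysis): if `rᵢ > e^{-μ}` then `q := rᵢ e^{μ} > 1`; from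
`x / (1 + x) ≤ log (1 + x)` (`x = Σⱼ rⱼ ^ m ≤ n`) one gets `q ^ m ≤ (n + 1) V C` for all `m ≥ m₀`,
contradicting `q ^ m → ∞`.  Ported from the crux-ideate sketch (`pressureForcesGap`). [folklore]
-/

noncomputable section

open scoped BigOperators
open Finset

namespace Summit.QuantumFields.YangMills.Theorems.WeakCouplingHypercubicLimit.TraceNormColdPressure

/-- **Pressure forces the gap ("`m → ∞` kills the volume").**  Normalised spectral data
`rᵢ ∈ [0, 1]` of a transfer matrix (top eigenvalue removed); if the trace excess obeys
`log(1 + Σᵢ rᵢ^m) ≤ V C e^{-μ m}` for all `m ≥ m₀` — a free-energy bound with an arbitrary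
(volume) prefactor `V > 0` — then every `rᵢ ≤ e^{-μ}`: the spectral gap is at least `μ`. [folklore] -/
theorem stub_pressureForcesGap :
    ∀ (n : ℕ) (r : Fin n → ℝ) (V C μ : ℝ) (m₀ : ℕ), (∀ i, 0 ≤ r i ∧ r i ≤ 1) → 0 < V →
      (∀ m : ℕ, m₀ ≤ m → Real.log (1 + ∑ i, r i ^ m) ≤ V * C * Real.exp (-μ * m)) →
      ∀ i, r i ≤ Real.exp (-μ) := by
  intro n r V C μ m₀ hr _hV hP i
  by_contra hlt
  push Not at hlt
  -- `q := r i · e^{μ} > 1`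
  set q : ℝ := r i * Real.exp μ with hq
  have hq1 : 1 < q := by
    have h1 : Real.exp (-μ) * Real.exp μ = 1 := by rw [← Real.exp_add]; simp
    calc (1 : ℝ) = Real.exp (-μ) * Real.exp μ := h1.symm
      _ < r i * Real.exp μ := mul_lt_mul_of_pos_right hlt (Real.exp_pos μ)
  -- `Σⱼ rⱼ ^ m ≤ n`
  have hsum_le : ∀ m : ℕ, ∑ j, r j ^ m ≤ n := fun m => by
    calc ∑ j, r j ^ m ≤ ∑ _j : Fin n, (1 : ℝ) :=
          Finset.sum_le_sum fun j _ => pow_le_one₀ (hr j).1 (hr j).2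
      _ = n := by simp
  -- for `m ≥ m₀`: `q ^ m ≤ (n + 1) V C`
  have hkey : ∀ m : ℕ, m₀ ≤ m → q ^ m ≤ (n + 1) * (V * C) := by
    intro m hm
    have hS0 : 0 ≤ ∑ j, r j ^ m := Finset.sum_nonneg fun j _ => pow_nonneg (hr j).1 _
    have hlog := hP m hm
    have hpos : 0 < 1 + ∑ j, r j ^ m := by linarith
    -- `x / (1 + x) ≤ log (1 + x)` for `x ≥ 0`, via `log y ≤ y - 1` at `y = 1 / (1 + x)`
    have hx : (∑ j, r j ^ m) / (1 + ∑ j, r j ^ m) ≤ Real.log (1 + ∑ j, r j ^ m) := by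
      have h2 := Real.log_le_sub_one_of_pos (inv_pos.mpr hpos)
      rw [Real.log_inv] at h2
      have h3 : (1 + ∑ j, r j ^ m)⁻¹ - 1 = -((∑ j, r j ^ m) / (1 + ∑ j, r j ^ m)) := by
        field_simp
        ring
      linarith [h2, h3]
    have hrm : r i ^ m ≤ ∑ j, r j ^ m :=
      Finset.single_le_sum (f := fun j => r j ^ m) (fun j _ => pow_nonneg (hr j).1 _) (mem_univ i)
    have h1x : 1 + ∑ j, r j ^ m ≤ n + 1 := by linarith [hsum_le m]
    -- `r i ^ m ≤ (n + 1) log (1 + Σ) ≤ (n + 1) V C e^{-μ m}`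
    have hA : r i ^ m ≤ (n + 1) * (V * C * Real.exp (-μ * m)) := by
      have hxl : (∑ j, r j ^ m) ≤ (1 + ∑ j, r j ^ m) * Real.log (1 + ∑ j, r j ^ m) := by
        have := (div_le_iff₀ hpos).mp hx
        linarith [this]
      have hlog0 : 0 ≤ Real.log (1 + ∑ j, r j ^ m) := Real.log_nonneg (by linarith)
      calc r i ^ m ≤ ∑ j, r j ^ m := hrm
        _ ≤ (1 + ∑ j, r j ^ m) * Real.log (1 + ∑ j, r j ^ m) := hxl
        _ ≤ (n + 1) * Real.log (1 + ∑ j, r j ^ m) :=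
            mul_le_mul_of_nonneg_right h1x hlog0
        _ ≤ (n + 1) * (V * C * Real.exp (-μ * m)) :=
            mul_le_mul_of_nonneg_left hlog (by positivity)
    -- multiply by `e^{μ m}`
    have hmul : r i ^ m * Real.exp (μ * m) ≤ (n + 1) * (V * C) := by
      have := mul_le_mul_of_nonneg_right hA (Real.exp_pos (μ * m)).le
      calc r i ^ m * Real.exp (μ * m)
            ≤ (n + 1) * (V * C * Real.exp (-μ * m)) * Real.exp (μ * m) := this
        _ = (n + 1) * (V * C) := by
            rw [mul_assoc, mul_assoc, mul_assoc, ← Real.exp_add]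
            simp
    calc q ^ m = r i ^ m * Real.exp (μ * m) := by
          rw [hq, mul_pow, ← Real.exp_nat_mul, mul_comm (m : ℝ) μ]
      _ ≤ (n + 1) * (V * C) := hmul
  -- but `q ^ m → ∞`
  have htend : Filter.Tendsto (fun m : ℕ => q ^ m) Filter.atTop Filter.atTop :=
    tendsto_pow_atTop_atTop_of_one_lt hq1
  obtain ⟨m, hm⟩ := Filter.tendsto_atTop_atTop.mp htend ((n + 1) * (V * C) + 1)
  have h := hm (max m m₀) (le_max_left _ _)
  have h' := hkey (max m m₀) (le_max_right _ _)
  linarith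

end Summit.QuantumFields.YangMills.Theorems.WeakCouplingHypercubicLimit.TraceNormColdPressure

end
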